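import Summits.NavierStokesRegularity.FluidComputer.RotorKnobTrigger
import HarnessLib

/-!
# The seed–rotor scale knob, part 3 of 6: the critical window and the clock after it

Part 3 of `RotorKnob*.lean` (cell `pub-fluidc`, blueprint seat bp1, gen 22; namespace
`Summit.NavierStokesRegularity.FluidComputer.RotorKnob`).
HONEST FRAMING: low prior, high value-of-information experiment on Tao's machine paradigm; NOT a
claim that NS blows up.
Five-mode ODE analysis of [Tao2016AveragedNS, §5.5] with the clock/amplifier scale `ε` and the
seed/rotor scale `ρ` kept apart; nothing is proved about Navier–Stokes.

THIS FILE: the sharp sub-solution `c_lower_sharp` (`c ≥ (ρ²/(4K⁵))e^{Mt²/2 - 1 - M}` on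
`[K⁻⁵, τ]`); `tc_window` — the first hitting time `τ` of the trigger level `K⁻¹⁰ρ²` satisfies
`2 - 24 log K/M ≤ τ² ≤ 2 + 2/M`, `1 ≤ τ ≤ 3/2`: the seed–rotor scale `ρ` CANCELS from the
hitting condition `2ρ²e^{Mt²/2 + 1 - M} ≈ K⁻¹⁰ρ²`, so the critical time `≈ √2` does not see `ρ`;
and the post-critical clock bound `b_lower_after` (`b ≥ ε/8` on `[τ, 2]` — THE step that spends
the exponential condition `ρ⁴ ≤ ε²e^{-18M}/(64M)`, via the crude bound `c ≤ 2ρ²e^{9M}` and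
`∂ₜb ≥ -ε⁻¹Mc²`). [cite: Tao2016AveragedNS, §5.5 (tcable), (c-bound), "b ≳ ε on [t_c,2]"].
No named facts; 0 sorry.
-/

noncomputable section

namespace Summit.NavierStokesRegularity.FluidComputer.RotorKnob

open Set Real Filter
open _root_.Topology
open Literature.Analysis.FluidPDE.Tao2016AveragedNS
open Literature.Analysis.FluidPDE.Tao2016AveragedNS.Thm53 (antitoneOn_intFactor monotoneOn_intFactor
  antitoneOn_sub_of_deriv_le monotoneOn_sub_of_le_deriv exists_hitTime abs_sub_le_of_abs_deriv_le
  sqrt_two_gt sqrt_two_lt invSqrt_facts Es_alg decay_alg numeric_N4 init_a init_b init_c init_d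
  init_e)

variable {K M ε ρ τ δ : ℝ} {X : ℝ → Fin 5 → ℝ}

/-- Sharp sub-solution for `c` on `[K⁻⁵, τ]` (needs `K⁻⁵ ≤ τ`):
`c(t) ≥ (ρ²/(4K⁵)) exp(Mt²/2 - 1 - M)` (integrating factor `exp(-(Mt²/2 - βt))`, first on
`[0,K⁻⁵]` where it is `≥ e^{-1/2}` because `M K⁻¹⁰ ≤ 1`, then on `[K⁻⁵,τ]`).
[cite: Tao2016AveragedNS, §5.5 proof of (tcable)] -/
theorem c_lower_sharp (hX : ∀ t, HasDerivAt X (rotorCircuit K M ε ρ (X t)) t) (h0 : X 0 = delayInit)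
    (hε : 0 < ε) (hρ : 0 < ρ) (hρε : ρ ^ 2 ≤ ε) (hM0 : 0 < M) (hMK : M ≤ K ^ 10) (hK : 2 ≤ K)
    (hτ2 : τ ≤ 2)
    (hτ5 : (K ^ 5)⁻¹ ≤ τ)
    (hεK : ε ^ 2 ≤ 1 / (6 * K ^ 20)) (hMρ : M * ρ ^ 4 ≤ ε ^ 2)
    (hcτ : ∀ t, 0 ≤ t → t ≤ τ → X t 2 ≤ ρ ^ 2 / K ^ 10)
    {t : ℝ} (ht : t ∈ Icc (K ^ 5)⁻¹ τ) :
    ρ ^ 2 / (4 * K ^ 5) * exp (M * t ^ 2 / 2 - 1 - M) ≤ X t 2 := by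
  have hK0 : 0 < K := by linarith
  have hK1 : 1 ≤ K := by linarith
  have hK68 : 68 ≤ K ^ 10 := by
    have : (2 : ℝ) ^ 10 ≤ K ^ 10 := pow_le_pow_left₀ (by norm_num) hK 10
    nlinarith
  set β : ℝ := 34 * M / K ^ 20 with hβ
  have hβ0 : 0 ≤ β := by positivity
  have hβ1 : β ≤ 1 / 2 := by
    simp only [hβ]; rw [div_le_div_iff₀ (by positivity) (by norm_num)]
    have : K ^ 20 = K ^ 10 * K ^ 10 := by ring
    nlinarith [pow_pos hK0 10]
  have hks₀' : M * ((K ^ 5)⁻¹ * (K ^ 5)⁻¹) ≤ 1 := by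
    rw [← mul_inv, ← pow_add, show (5 + 5 : ℕ) = 10 from rfl, ← div_eq_mul_inv,
      div_le_one (by positivity)]
    exact hMK
  set k : ℝ := M with hk
  have hk0 : 0 < k := hM0
  set μ : ℝ := ρ ^ 2 * exp (-k) with hμ
  have hμ0 : 0 ≤ μ := by positivity
  set s₀ : ℝ := (K ^ 5)⁻¹ with hs₀
  have hs₀0 : 0 < s₀ := by positivity
  have hks₀ : k * (s₀ * s₀) ≤ 1 := hks₀'
  -- integrating factor `G(s) = k s²/2 - β s`
  have hG : ∀ s, HasDerivAt (fun r : ℝ => k / 2 * (r * r) - β * r) (k * s - β) s := by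
    intro s
    have := (((hasDerivAt_id s).mul (hasDerivAt_id s)).const_mul (k / 2)).sub
      ((hasDerivAt_id s).const_mul β)
    exact this.congr_deriv (by simp; ring)
  -- the bracket `(c' - (ks-β)c) e^{-G} ≥ (μ/2) e^{-G}` on `[0,τ]`
  have hbr : ∀ s ∈ Icc 0 τ, μ / 2 * exp (-(k / 2 * (s * s) - β * s)) ≤
      (ρ ^ 2 * exp (-M) * X s 0 ^ 2 + ε⁻¹ * M * X s 1 * X s 2
        - (k * s - β) * X s 2) * exp (-(k / 2 * (s * s) - β * s)) := by
    intro s hs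
    have hc0 : 0 ≤ X s 2 := c_nonneg hX h0 hs.1
    have ha1 : |X s 0 - 1| ≤ 8 / K ^ 20 := a_near_one hX h0 hε hρ hρε hM0.le hK1 hτ2 hεK hcτ hs
    have hb : |X s 1 - ε * s| ≤ 17 * ε / K ^ 20 * s :=
      b_linear hX h0 hε hρ hρε hM0 hK1 hτ2 hεK hMρ hcτ hs
    have hs2 : s ≤ 2 := hs.2.trans hτ2
    -- `a² ≥ 1/2`
    have hK20 : 8 / K ^ 20 ≤ 1 / 4 := by
      rw [div_le_div_iff₀ (by positivity) (by norm_num)]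
      have : (2 : ℝ) ^ 20 ≤ K ^ 20 := pow_le_pow_left₀ (by norm_num) hK 20
      nlinarith
    have ha_lo : 3 / 4 ≤ X s 0 := by have := (abs_le.1 ha1).1; linarith
    have ha2 : 1 / 2 ≤ X s 0 ^ 2 := by nlinarith
    -- `ν b ≥ k s - β`
    have hνb : k * s - β ≤ ε⁻¹ * M * X s 1 := by
      have hb' : ε * s - 17 * ε / K ^ 20 * s ≤ X s 1 := by
        have := (abs_le.1 hb).1; linarith
      have h34 : 17 * ε / K ^ 20 * s ≤ 34 * ε / K ^ 20 := by
        have h2s : 17 * ε / K ^ 20 * s ≤ 17 * ε / K ^ 20 * 2 :=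
          mul_le_mul_of_nonneg_left hs2 (by positivity)
        have h2e : 17 * ε / K ^ 20 * 2 = 34 * ε / K ^ 20 := by ring
        linarith
      calc k * s - β = ε⁻¹ * M * (ε * s - 34 * ε / K ^ 20) := by
            simp only [hβ, hk]; field_simp
        _ ≤ ε⁻¹ * M * X s 1 :=
            mul_le_mul_of_nonneg_left (by linarith) (by positivity)
    have h1 : μ / 2 ≤ ρ ^ 2 * exp (-M) * X s 0 ^ 2 := by
      have : ρ ^ 2 * exp (-M) * (1 / 2) ≤ ρ ^ 2 * exp (-M) * X s 0 ^ 2 :=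
        mul_le_mul_of_nonneg_left ha2 (by positivity)
      simp only [hμ, hk] at this ⊢; linarith
    have h2 : (k * s - β) * X s 2 ≤ ε⁻¹ * M * X s 1 * X s 2 :=
      mul_le_mul_of_nonneg_right hνb hc0
    have hbr' : μ / 2 ≤ ρ ^ 2 * exp (-M) * X s 0 ^ 2 + ε⁻¹ * M * X s 1 * X s 2
        - (k * s - β) * X s 2 := by linarith
    exact mul_le_mul_of_nonneg_right hbr' (exp_pos _).le
  -- Stage A: on `[0, s₀]`, `e^{-G} ≥ 1/2`, so `c e^{-G} - (μ/4) s` is monotone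
  have hs₀τ : s₀ ≤ τ := hτ5
  have hmonoA := monotoneOn_intFactor (s := Icc 0 s₀) (g := fun s => k * s - β)
    (G := fun r => k / 2 * (r * r) - β * r) (φ := fun _ => μ / 4) (Φ := fun s => μ / 4 * s)
    (convex_Icc 0 s₀) (fun s _ => hasDerivAt_c hX s) (fun s _ => hG s)
    (fun s _ => ((hasDerivAt_id s).const_mul (μ / 4)).congr_deriv (by simp))
    (fun s hs => by
      have hsτ : s ∈ Icc 0 τ := ⟨hs.1, hs.2.trans hs₀τ⟩
      have hexp : 1 / 2 ≤ exp (-(k / 2 * (s * s) - β * s)) := by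
        have hss : k * (s * s) ≤ 1 := by
          calc k * (s * s) ≤ k * (s₀ * s₀) := by
                exact mul_le_mul_of_nonneg_left (mul_self_le_mul_self hs.1 hs.2) hk0.le
            _ ≤ 1 := hks₀
        have harg : -(1 / 2 : ℝ) ≤ -(k / 2 * (s * s) - β * s) := by
          have : 0 ≤ β * s := mul_nonneg hβ0 hs.1
          linarith
        calc (1 / 2 : ℝ) ≤ exp (-(1 / 2 : ℝ)) := by
              have h := Real.add_one_le_exp (-(1 / 2 : ℝ))
              linarith
          _ ≤ exp (-(k / 2 * (s * s) - β * s)) := exp_le_exp.2 harg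
      calc μ / 4 = μ / 2 * (1 / 2) := by ring
        _ ≤ μ / 2 * exp (-(k / 2 * (s * s) - β * s)) :=
            mul_le_mul_of_nonneg_left hexp (by positivity)
        _ ≤ _ := hbr s hsτ)
  have hA := hmonoA (⟨le_rfl, hs₀0.le⟩ : (0 : ℝ) ∈ Icc 0 s₀) ⟨hs₀0.le, le_rfl⟩ hs₀0.le
  simp only [init_c h0, zero_mul, mul_zero, sub_zero] at hA
  -- Stage B: on `[s₀, τ]`, `c e^{-G}` is monotone
  have hmonoB := monotoneOn_intFactor (s := Icc s₀ τ) (g := fun s => k * s - β)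
    (G := fun r => k / 2 * (r * r) - β * r) (φ := fun _ => 0) (Φ := fun _ => 0)
    (convex_Icc s₀ τ) (fun s _ => hasDerivAt_c hX s) (fun s _ => hG s)
    (fun s _ => hasDerivAt_const s (0 : ℝ))
    (fun s hs => by
      have hsτ : s ∈ Icc 0 τ := ⟨hs₀0.le.trans hs.1, hs.2⟩
      exact le_trans (by positivity) (hbr s hsτ))
  have hB := hmonoB (⟨le_rfl, hs₀τ⟩ : s₀ ∈ Icc s₀ τ) ht ht.1
  simp only [sub_zero] at hB
  -- combine: `c t e^{-G t} ≥ μ/4 s₀`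
  have hct : μ / 4 * s₀ ≤ X t 2 * exp (-(k / 2 * (t * t) - β * t)) := by linarith
  have ht0 : 0 ≤ t := hs₀0.le.trans ht.1
  have ht2 : t ≤ 2 := ht.2.trans hτ2
  have hE : X t 2 = X t 2 * exp (-(k / 2 * (t * t) - β * t)) * exp (k / 2 * (t * t) - β * t) := by
    rw [mul_assoc, ← exp_add, neg_add_cancel, exp_zero, mul_one]
  rw [hE]
  calc ρ ^ 2 / (4 * K ^ 5) * exp (M * t ^ 2 / 2 - 1 - M)
      = μ / 4 * s₀ * exp (k / 2 * (t * t) - 1) := by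
        simp only [hμ, hk, hs₀]
        rw [show M * t ^ 2 / 2 - 1 - M = -M + (M / 2 * (t * t) - 1) by ring,
          exp_add (-M)]
        field_simp
    _ ≤ μ / 4 * s₀ * exp (k / 2 * (t * t) - β * t) := by
        have hβt : β * t ≤ 1 := by nlinarith
        exact mul_le_mul_of_nonneg_left (exp_le_exp.2 (by linarith)) (by positivity)
    _ ≤ X t 2 * exp (-(k / 2 * (t * t) - β * t)) * exp (k / 2 * (t * t) - β * t) :=
        mul_le_mul_of_nonneg_right hct (exp_pos _).le



/-! ## Numerics for the critical window -/


/-! ## The critical window, read off from the hitting condition (no `K⁹` numerics) -/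


/-- **(tcable) and (c-bound) for the family.** If `τ` is the first hitting time of the level
`K⁻¹⁰ρ²` by `c` on `[0,2]`, then `2 - 24 log K / M ≤ τ² ≤ 2 + 2/M` (so `1 ≤ τ ≤ 3/2` once
`48 log K ≤ M`) and `c(τ) = K⁻¹⁰ρ²` — the seed–rotor scale `ρ` CANCELS from the window. The lower
edge is the super-solution evaluated at the hitting
time (`K⁻¹⁰ ≤ 2e^{Mτ²/2 + 1 - M}`, then `log`); the upper edge is the sub-solution at
`T = √(2 + 2/M)`, where it already exceeds the level (`4K⁵ < K¹⁰`).
[cite: Tao2016AveragedNS, §5.5 (tcable), (c-bound)] -/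
theorem tc_window (hX : ∀ t, HasDerivAt X (rotorCircuit K M ε ρ (X t)) t) (h0 : X 0 = delayInit)
    (hε : 0 < ε) (hρ : 0 < ρ) (hρε : ρ ^ 2 ≤ ε) (hM0 : 0 < M) (hMK : M ≤ K ^ 10) (hK : 16 ≤ K)
    (hML : 48 * Real.log K ≤ M) (hεK : ε ^ 2 ≤ 1 / (6 * K ^ 20)) (hMρ : M * ρ ^ 4 ≤ ε ^ 2)
    (hτ0 : 0 < τ) (hτ2 : τ ≤ 2)
    (hcτ : ∀ t, 0 ≤ t → t ≤ τ → X t 2 ≤ ρ ^ 2 / K ^ 10)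
    (hτeq : τ < 2 → X τ 2 = ρ ^ 2 / K ^ 10) :
    2 - 24 * Real.log K / M ≤ τ ^ 2 ∧ τ ^ 2 ≤ 2 + 2 / M ∧ 1 ≤ τ ∧ τ ≤ 3 / 2 ∧
      X τ 2 = ρ ^ 2 / K ^ 10 := by
  have hK2 : 2 ≤ K := by linarith
  have hK0 : 0 < K := by linarith
  obtain ⟨hlog, hlog2, hlog0⟩ := Thm53With.log_facts hK
  -- late side: `τ² ≤ 2 + 2/M`
  have hlate : τ ^ 2 ≤ 2 + 2 / M := by
    by_contra hlt'
    have hlt := not_le.1 hlt'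
    set T := sqrt (2 + 2 / M) with hT
    have hT0 : 0 ≤ T := sqrt_nonneg _
    have hT2 : T ^ 2 = 2 + 2 / M := sq_sqrt (by positivity)
    have hTτ : T < τ := by
      rw [← hT2] at hlt
      exact lt_of_pow_lt_pow_left₀ 2 hτ0.le hlt
    have hT1 : 1 ≤ T := by
      rw [hT, le_sqrt (by norm_num) (by positivity)]
      have : 0 ≤ 2 / M := by positivity
      linarith
    have hT5 : (K ^ 5)⁻¹ ≤ T := by
      have : (K ^ 5)⁻¹ ≤ 1 := inv_le_one_of_one_le₀ (one_le_pow₀ (by linarith))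
      linarith
    have hτ5 : (K ^ 5)⁻¹ ≤ τ := by linarith
    have hlow :=
        c_lower_sharp hX h0 hε hρ hρε hM0 hMK hK2 hτ2 hτ5 hεK hMρ hcτ (t := T) ⟨hT5, hTτ.le⟩
    have hcT : X T 2 ≤ ρ ^ 2 / K ^ 10 := hcτ T (by linarith) hTτ.le
    have hexp0 : M * T ^ 2 / 2 - 1 - M = 0 := by rw [hT2]; field_simp; ring
    rw [hexp0, exp_zero, mul_one] at hlow
    have h : ρ ^ 2 / (4 * K ^ 5) ≤ ρ ^ 2 / K ^ 10 := hlow.trans hcT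
    rw [div_le_div_iff₀ (by positivity) (by positivity)] at h
    have hρ2 : 0 < ρ ^ 2 := by positivity
    have h' : K ^ 10 ≤ 4 * K ^ 5 := le_of_mul_le_mul_left (by linarith) hρ2
    have h5 : (16 : ℝ) ^ 5 ≤ K ^ 5 := pow_le_pow_left₀ (by norm_num) hK 5
    nlinarith [pow_pos hK0 5]
  have hM96 : 96 ≤ M := by linarith
  have hτ32 : τ ≤ 3 / 2 := by
    have h2M : 2 / M ≤ 1 / 4 := by
      rw [div_le_div_iff₀ hM0 (by norm_num)]; linarith
    nlinarith
  have hτlt2 : τ < 2 := by linarith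
  have hcτeq := hτeq hτlt2
  -- early side: `2 - 24 log K / M ≤ τ²`
  have hearly : 2 - 24 * Real.log K / M ≤ τ ^ 2 := by
    have hup := c_upper_sharp hX h0 hε hρ hρε hM0 hMK hK2 hτ2 hεK hMρ hcτ (t := τ) ⟨hτ0.le, le_rfl⟩
    rw [hcτeq] at hup
    -- `1/(2K¹⁰) ≤ exp(Mτ²/2 + 1 - M)`
    have h1 : 1 / (2 * K ^ 10) ≤ exp (M * τ ^ 2 / 2 + 1 - M) := by
      rw [div_le_iff₀ (by positivity)]
      have hρ2 : 0 < ρ ^ 2 := by positivity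
      have : ρ ^ 2 * 1 ≤ ρ ^ 2 * (exp (M * τ ^ 2 / 2 + 1 - M) * (2 * K ^ 10)) := by
        calc ρ ^ 2 * 1 = ρ ^ 2 / K ^ 10 * K ^ 10 := by field_simp
          _ ≤ 2 * ρ ^ 2 * exp (M * τ ^ 2 / 2 + 1 - M) * K ^ 10 :=
              mul_le_mul_of_nonneg_right hup (by positivity)
          _ = ρ ^ 2 * (exp (M * τ ^ 2 / 2 + 1 - M) * (2 * K ^ 10)) := by ring
      exact le_of_mul_le_mul_left this hρ2
    have h2 : Real.log (1 / (2 * K ^ 10)) ≤ M * τ ^ 2 / 2 + 1 - M := by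
      have := Real.log_le_log (by positivity) h1
      rwa [Real.log_exp] at this
    have h3 : Real.log (1 / (2 * K ^ 10)) = -(Real.log 2 + 10 * Real.log K) := by
      rw [one_div, Real.log_inv, Real.log_mul (by norm_num) (by positivity), Real.log_pow]
      push_cast; ring
    rw [h3] at h2
    -- `M (1 - τ²/2) ≤ 1 + log 2 + 10 log K ≤ 12 log K`
    have h4 : M * (2 - τ ^ 2) ≤ 24 * Real.log K := by nlinarith
    have : 2 - τ ^ 2 ≤ 24 * Real.log K / M := by
      rw [le_div_iff₀ hM0]; linarith
    linarith
  have hτ1 : 1 ≤ τ := by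
    have h24 : 24 * Real.log K / M ≤ 1 / 2 := by
      rw [div_le_div_iff₀ hM0 (by norm_num)]; linarith
    nlinarith
  exact ⟨hearly, hlate, hτ1, hτ32, hcτeq⟩



/-! ## After the critical time: `b ≳ ε`, (c-large), (cgrow-2) -/


/-- `b ≥ ε/8` on `[τ,2]` ("`b(t) ≳ ε` for `t ∈ [t_c,2]`", from (bogo-2) at `t_c` and
`∂ₜb ≥ -4Mε⁻¹ρ⁴e^{18M} ≥ -ε/16`). [cite: Tao2016AveragedNS, §5.5 proof] -/
theorem b_lower_after (hX : ∀ t, HasDerivAt X (rotorCircuit K M ε ρ (X t)) t) (h0 : X 0 = delayInit)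
    (hε : 0 < ε) (hρ : 0 < ρ) (hρε : ρ ^ 2 ≤ ε) (hM0 : 0 < M) (hK : 16 ≤ K)
    (hεK : ε ^ 2 ≤ 1 / (6 * K ^ 20)) (hMρ : M * ρ ^ 4 ≤ ε ^ 2)
    (hρexp : ρ ^ 4 ≤ ε ^ 2 * exp (-(18 * M)) / (64 * M))
    (hτ1 : 1 ≤ τ) (hτ2 : τ ≤ 2)
    (hcτ : ∀ t, 0 ≤ t → t ≤ τ → X t 2 ≤ ρ ^ 2 / K ^ 10)
    {t : ℝ} (ht : t ∈ Icc τ 2) : ε / 8 ≤ X t 1 := by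
  have hK0 : 0 < K := by linarith
  have hK1 : 1 ≤ K := by linarith
  set k : ℝ := M with hk
  have hk0 : 0 < k := hM0
  -- `b(τ) ≥ ε/2`
  have hbτ : ε / 2 ≤ X τ 1 := by
    have hb := b_linear hX h0 hε hρ hρε hM0 hK1 hτ2 hεK hMρ hcτ (t := τ) ⟨by linarith, le_rfl⟩
    have h1 := (abs_le.1 hb).1
    have hK20 : 34 / K ^ 20 ≤ 1 / 2 := by
      rw [div_le_div_iff₀ (by positivity) (by norm_num)]
      have : (2 : ℝ) ^ 20 ≤ K ^ 20 := pow_le_pow_left₀ (by norm_num) (by linarith) 20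
      nlinarith
    have h2 : 17 * ε / K ^ 20 * τ ≤ 34 / K ^ 20 * ε := by
      have : 17 * ε / K ^ 20 * τ ≤ 17 * ε / K ^ 20 * 2 :=
        mul_le_mul_of_nonneg_left hτ2 (by positivity)
      have h2e : 17 * ε / K ^ 20 * 2 = 34 / K ^ 20 * ε := by ring
      linarith
    have h3 : 34 / K ^ 20 * ε ≤ 1 / 2 * ε := mul_le_mul_of_nonneg_right hK20 hε.le
    nlinarith
  -- `∂ₜb ≥ -ε/16` on `[τ,2]`
  have hmono := monotoneOn_sub_of_le_deriv (φ := fun _ => -(ε / 16))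
    (Φ := fun s => -(ε / 16) * s) (convex_Icc τ 2) (fun s _ => hasDerivAt_b hX s)
    (fun s _ => ((hasDerivAt_id s).const_mul (-(ε / 16))).congr_deriv (by simp))
    (fun s hs => by
      have hs02 : s ∈ Icc (0 : ℝ) 2 := ⟨by linarith [hs.1], hs.2⟩
      have hc0 : 0 ≤ X s 2 := c_nonneg hX h0 hs02.1
      have hcc : X s 2 ≤ 2 * ρ ^ 2 * exp ((5 * s - 1) * k) := c_crude hX h0 hε hρ hρε hM0.le hs02
      have hc9 : X s 2 ≤ 2 * ρ ^ 2 * exp (9 * k) := by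
        refine hcc.trans (mul_le_mul_of_nonneg_left (exp_le_exp.2 ?_) (by positivity))
        simp only [hk]; nlinarith [hs.2]
      have hc2 : X s 2 ^ 2 ≤ (2 * ρ ^ 2 * exp (9 * k)) ^ 2 := pow_le_pow_left₀ hc0 hc9 2
      -- `ν c² ≤ 4 k ε⁻¹ ρ⁴ e^{18k} ≤ ε/16`
      have hνc : ε⁻¹ * M * X s 2 ^ 2 ≤ ε / 16 := by
        have hρ2 : ρ ^ 4 * exp (18 * k) ≤ ε ^ 2 / (64 * k) := by
          have := hρexp
          calc ρ ^ 4 * exp (18 * k) ≤ ε ^ 2 * exp (-(18 * k)) / (64 * k) * exp (18 * k) :=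
                mul_le_mul_of_nonneg_right this (exp_pos _).le
            _ = ε ^ 2 / (64 * k) := by
                rw [div_mul_eq_mul_div, mul_assoc, ← exp_add, neg_add_cancel, exp_zero, mul_one]
        calc ε⁻¹ * M * X s 2 ^ 2 ≤ ε⁻¹ * M * (2 * ρ ^ 2 * exp (9 * k)) ^ 2 :=
              mul_le_mul_of_nonneg_left hc2 (by positivity)
          _ = 4 * k * ε⁻¹ * (ρ ^ 4 * exp (18 * k)) := by
              rw [show (18 : ℝ) * k = 9 * k + 9 * k by ring, exp_add]
              ring
          _ ≤ 4 * k * ε⁻¹ * (ε ^ 2 / (64 * k)) := mul_le_mul_of_nonneg_left hρ2 (by positivity)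
          _ = ε / 16 := by field_simp; ring
      have ha2 : 0 ≤ ε * X s 0 ^ 2 := by positivity
      linarith)
  have hτmem : τ ∈ Icc τ 2 := ⟨le_rfl, hτ2⟩
  have h := hmono hτmem ht ht.1
  simp only at h
  have : t - τ ≤ 1 := by linarith [ht.2]
  nlinarith

end Summit.NavierStokesRegularity.FluidComputer.RotorKnob
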